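import Mathlib
import HarnessLib
import HarnessLib.Audit
import Summits.Parity.Statement
import Literature.NumberTheory.Sieve.SingularSeries
import Literature.NumberTheory.Sieve.LinearEquationsInPrimesCrudeBounds

/-!
Route: ClusterGapCarving

DORMANT since 2026-09-04T14:29:31Z (reconciler: no traction for 5 d (last activity statement-checked at 2026-08-30T13:43:14Z); parked, not closed — `ledger route dormant route-Parity-ClusterGapCarving --off` to reactivate) — unstaffed, not closed; items shared with open routes are served there. `ledger route dormant <id> --off` reactivates.

# Route ClusterGapCarving — GHL ⟸ some ε-exact shift pair ∧ pair sync with the twins ∧ the declared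
twin residual ∧ the 0/1 bias dichotomy — twin HL derived

decomp-parity (D-0178/D-0179) lens-6 g2 node «ClusterGapCarving» (R1 form, critic
CLEARED-WITH-REPAIRS 2026-08-30T03:17:15Z), ROOT-CONJUNCT
node on GHL (BH rides as the sibling of `Parity ⟺ BH ∧ GHL`). Carving axis = the cluster-gap
geometry of PARALLEL pairs of forms (far cell /
bounded clusters / the absorbing near-mixed cell); the node pieces are the PAIR SHADOWS of the two
non-absorbing cells — exactly what the
kernel assembly consumes. It suffices to show X = Far∃ ∧ PairSync ∧ Residual ∧ Dichotomy:
FarSomePair (for every ε SOME even shift pair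
(n, n+h), h = h(ε), is ε-exact: |Σ_(n≤N) Λ(n)Λ(n+h) − 𝔖(h)N| ≤ εN eventually), PairSync (every even
shift pair has the twins' bias:
|X_N(h)·𝔖(2) − T_N·𝔖(h)| ≤ εN eventually), TwinResidualRel (the cell's blocker residual, declared:
Λ-Chebyshev twin lower bound →
relative GHL), BiasDichotomy (bias 0 or 1 at the absolute scale). Far∃ ∧ PairSync give the twin HL
asymptotic (kernel, HOME file
`twinHL_of_pair_sync`), hence the residual's antecedent; the residual gives relative GHL; the
dichotomy upgrades to absolute GHL.
Exactness GHL ⟺ X is kernel-checked (`ghl_iff_pieces`, HOME file); the ∀-forms FarClusterGHL /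
BoundedClusterSync are recorded necessary
consequences (double-booked surplus, zero credit).
Lean: `(∀ ε : ℝ, 0 < ε → ∃ h : ℕ, h ≠ 0 ∧ Even h ∧ ∃ N₀ : ℕ, ∀ N : ℕ, N₀ ≤ N → |(∑ n ∈ Finset.Icc 1
N, ArithmeticFunction.vonMangoldt n * ArithmeticFunction.vonMangoldt (n + h)) - (N : ℝ) *
Literature.NumberTheory.Sieve.singularSeries ({0, (h : ℤ)} : Finset ℤ)| ≤ ε * N) ∧ (∀ h : ℕ, h ≠ 0 →
Even h → ∀ ε : ℝ, 0 < ε → ∃ N₀ : ℕ, ∀ N : ℕ, N₀ ≤ N → |(∑ n ∈ Finset.Icc 1 N,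
ArithmeticFunction.vonMangoldt n * ArithmeticFunction.vonMangoldt (n + h)) *
Literature.NumberTheory.Sieve.singularSeries ({0, 2} : Finset ℤ) - (∑ n ∈ Finset.Icc 1 N,
ArithmeticFunction.vonMangoldt n * ArithmeticFunction.vonMangoldt (n + 2)) *
Literature.NumberTheory.Sieve.singularSeries ({0, (h : ℤ)} : Finset ℤ)| ≤ ε * N) ∧ ((∃ c : ℝ, 0 < c
∧ ∃ N₀ : ℕ, ∀ N : ℕ, N₀ ≤ N → c * (N : ℝ) ≤ ∑ n ∈ Finset.Icc 1 N, ArithmeticFunction.vonMangoldt n *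
ArithmeticFunction.vonMangoldt (n + 2)) → ∀ (d t L : ℕ), 1 ≤ d → 1 ≤ t → ∀ ε : ℝ, 0 < ε → ∃ N₀ : ℕ,
∀ N : ℕ, N₀ ≤ N → ∀ Ψ : Fin t → Literature.NumberTheory.Sieve.AffLinForm d,
Literature.NumberTheory.Sieve.IsNondegenerateSystem Ψ → Literature.NumberTheory.Sieve.affLinSize Ψ N
≤ L → ∀ K : Set (Fin d → ℝ), Convex ℝ K → K ⊆ Literature.NumberTheory.Sieve.realBox d N →
|Literature.NumberTheory.Sieve.vonMangoldtSum Ψ K N - Literature.NumberTheory.Sieve.archFactor Ψ K *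
Literature.NumberTheory.Sieve.singularProduct Ψ| ≤ ε * ((N : ℝ) ^ d +
|Literature.NumberTheory.Sieve.archFactor Ψ K * Literature.NumberTheory.Sieve.singularProduct Ψ|)) ∧
(∀ (d t L : ℕ), 1 ≤ d → 1 ≤ t → ∀ ε : ℝ, 0 < ε → ∃ N₀ : ℕ, ∀ N : ℕ, N₀ ≤ N → ∀ Ψ : Fin t →
Literature.NumberTheory.Sieve.AffLinForm d, Literature.NumberTheory.Sieve.IsNondegenerateSystem Ψ →
Literature.NumberTheory.Sieve.affLinSize Ψ N ≤ L → ∀ K : Set (Fin d → ℝ), Convex ℝ K → K ⊆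
Literature.NumberTheory.Sieve.realBox d N → Literature.NumberTheory.Sieve.vonMangoldtSum Ψ K N *
|Literature.NumberTheory.Sieve.vonMangoldtSum Ψ K N - Literature.NumberTheory.Sieve.archFactor Ψ K *
Literature.NumberTheory.Sieve.singularProduct Ψ| ≤ ε * (N : ℝ) ^ d * ((N : ℝ) ^ d +
|Literature.NumberTheory.Sieve.archFactor Ψ K * Literature.NumberTheory.Sieve.singularProduct Ψ|))`

## Assembly
From hE : TwinLowerFromPairSync applied to hF : FarSomePair, hS : PairSync get the twin Chebyshev
lower bound; hR turns it into relative GHL |S − M| ≤ η(N^d + |M|) with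
η = min(ε/4, 1/4); if |M| ≤ N^d this is ≤ εN^d; otherwise M > 0 and S ≥ M/2 follow from the relative
bound, and hD (at ε/4) gives
(M/2)|S − M| ≤ (ε/4)N^d(N^d + M) ≤ (ε/4)N^d·2M, i.e. |S − M| ≤ εN^d. All five binders are consumed
(`closes` in glue.lean, elementary real
arithmetic); the Assembly item records the implication shape (the deciding theorem is `closes`).
Exactness GHL ⟺ Far∃ ∧ PairSync ∧ Residual ∧ Dichotomy, the recorded ∀-form layer GHL ⟺
FarClusterGHL ∧ BoundedClusterSync ∧ Residual ∧
Dichotomy and the coarse layer GHL ⟺ FarClusterGHL ∧ Dichotomy ∧ TightClusterTransfer are kernel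
theorems of the HOME file (ghl_iff_pieces,
ghl_iff_clusterPieces, ghl_iff_coarse).

Rationale: WHY THIS LINE. The catalogued obstructions to GHL (parity: Selberg1949, Bombieri1976,
FordMaynard2024; exceptional zeros: MatomakiMerikoski2023,
FriedlanderIwaniec2022) are statements about the Hardy–Littlewood VALUE of ONE FIXED tight cluster
(twins, a k-tuple). Cutting GHL by
the tight/far geometry of parallel pairs and keeping only what the assembly consumes separates a
piece that fixes no pair (FarSomePair:
for each ε some pair, possibly farther and farther out, is ε-exact — GreenTao2010 Conj. 1.2 on one
pair at a time) from a piece that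
names no value (PairSync: a COMPARISON — every even shift pair is exactly as biased as the twins),
and proves in the kernel that the two
together already yield Σ_(n≤N) Λ(n)Λ(n+2) = 𝔖₂N + o(N) (HardyLittlewood1923 for twins): synchronise
the ε-exact pair with the twins and
use 1 ≤ 𝔖(2) ≤ 𝔖(h) uniformly in even h (Gallagher1976 singular series). Both pieces are
Siegel-INERT (fixed shifts carry the standard
singular series in the exceptional range: FriedlanderIwaniec2022 / Heath-Brown 1983,
arXiv:1607.03261), so the Landau–Siegel weight of
GHL is confined to the residual and the dichotomy. The third cell (systems with a tight pair AND a
far or non-parallel pair) is absorbing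
under products with the twin system (critic trap T9), so it is quarantined as the declared residual
of record (stmt-Parity-18380 / 9389
class) in the weakest form the assembly needs; what the geometry buys is that the residual's
ANTECEDENT (the twin leaf, stmt-Parity-18377
in Λ-form) is derived from two hypothesis-free, necessary, strictly weaker, Siegel-inert pieces — a
level-2 derivation of the twin leaf.
Versus prior routes: every GHL decomposition on the ledger is «pair bricks ∧ exchange-rate residual»
with the twin leaf ASSUMED;
SiegelSpectrumSplit cuts by Siegel quality (orthogonal axis).

RANKED CRUXES. #2 PairSync (crux) — for every even h ≠ 0 and ε > 0, eventually in N: |X_N(h)·𝔖(2) −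
T_N·𝔖(h)| ≤ εN, where X_N(h) = Σ_(n≤N) Λ(n)Λ(n+h), T_N = X_N(2) and 𝔖(h) = singularSeries {0,h}:
every even shift pair has the twins' bias (a comparison, no value; WEAKER: kernel necessity;
separating world «all infinite-complexity biases 0»; with TwinHL it reaches only HL for fixed even
shift pairs, never shift-uniformity / Goldbach / k-tuples / d ≥ 2; Siegel-inert). [difficulty:
open-problem] (why it might fail: sieve-axiom models allow h-dependent biases ρ(h) ∈ [0,2]
(Selberg/Bombieri indeterminacy), so a proof needs a universality mechanism beyond Type-I/II
bookkeeping — none is known; refutation would need a proved bias gap between two fixed shifts,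
equally out of reach.) [Bombieri1976, Selberg1949, HardyLittlewood1923, Gallagher1976,
FriedlanderIwaniec2022, arXiv:1607.03261]
#3 FarSomePair (crux) — for every ε > 0 there are an even shift h ≠ 0 (depending on ε) and N₀ with
|Σ_(n≤N) Λ(n)Λ(n+h) − 𝔖(h)·N| ≤ εN for all N ≥ N₀: SOME shift pair is ε-exact (WEAKER: kernel
necessity with h = 2; strictly below the twin leaf — TwinHL ⟹ it, not conversely; separating world
«cousin pairs exact, finitely many twins, all other biases 0»; the pair shadow of far-cluster GHL,
Siegel-inert). [difficulty: open-problem] (why it might fail: its content — prime pairs at SOME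
bounded gap with the full Hardy–Littlewood proportion up to ε — is beyond Zhang–Maynard–Polymath
densities N/(log N)^k and parity-blocked for Type-I/II methods (the ∃ over h does not leave the
sieve-indeterminacy class).) [GreenTao2010, Zhang2014, Maynard2015, Pintz2015, arXiv:1410.8400,
MontgomeryVaughan1975]
#4 BiasDichotomy (crux) — in the full Green–Tao quantifier block: S·|S − β_∞∏β_p| ≤ εN^d(N^d +
|β_∞∏β_p|) — every system is either rare at the absolute scale or asymptotically exact (bias 0 or 1,
nothing in between); WEAKER (kernel necessity; separating world «all infinite-complexity biases 0»);
its only role is the relative → absolute upgrade for systems whose singular series exceeds N^d/β_∞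
(∏β_p reaches ≍ log log N on ‖Ψ‖_N ≤ L); Siegel-LOADED on growing shifts (MM2023 excess factor 2 at
h = 2q = bias 2). [difficulty: open-problem] (why it might fail: sieve-axiom models (Bombieri's
asymptotic sieve, Selberg's examples) admit every bias in [0,2], so a proof must use primality
beyond Type-I/II bookkeeping; an intermediate bias for some smooth-shift family at scales with ∏β_p
≍ log log N is not excluded by anything known.) [Bombieri1976, Selberg1949, GreenTao2010,
FordMaynard2024]
#5 TwinResidualRel (crux) — DECLARED-RESIDUAL (critic trap T6) = the cell's blocker residual of
record (OneSidedAggregateExchangeRate.TwinLowerDensityToGHL, stmt-Parity-18380; PairsToGHL 9389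
class) in the weakest form this assembly needs: IF Σ_(n≤N) Λ(n)Λ(n+2) ≥ cN eventually for some c > 0
(Λ-form of stmt-Parity-18377 — DERIVED in this route from FarSomePair ∧ PairSync, support
TwinLowerFromPairSync) THEN relative GHL: the Green–Tao block with error ε(N^d + |β_∞∏β_p|). Not
claimed weaker than last round except formally (relative vs absolute error, Λ vs count antecedent);
irreducible along the cluster axis (the near-mixed cell is absorbing under ⊠ twins); T4: the
growing-shift / Goldbach / k-tuple / d ≥ 2 uniformity locus of GHL lives here; Siegel-LOADED (MM2023
growing shifts h = 2q). [deps: FarSomePair, PairSync] [difficulty: open-problem] (why it might fail: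
as a target it is summit-strength in the strategists' census (an inert antecedent: twin lower bounds
give no handle on Goldbach-type shift uniformity or on the Landau–Siegel content, MM2023 families h
= 2q); it is carried, not attacked, until a later round weakens it.) [GreenTao2010,
MatomakiMerikoski2023, HeathBrown1983PrimeTwins, FriedlanderIwaniec2022]
#9 TwinLowerFromPairSync (support) — glue, PROVED in kernel in the HOME file
(ClusterGapCarving.lean: twinChebyshevLower_of_pair_sync via twinHL_of_pair_sync, 0 sorry, standard
axioms, ready to land in Theorems/): FarSomePair and PairSync imply the Λ-Chebyshev twin lower bound
Σ_(n≤N) Λ(n)Λ(n+2) ≥ N/2 eventually (indeed the twin HL asymptotic |T_N − 𝔖(2)N| ≤ δN): take the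
(δ/2𝔖(2))-exact pair h, synchronise it with the twins at δ/2, use 1 ≤ 𝔖(2) ≤ 𝔖(h): |T − N𝔖(2)|·𝔖(h)
≤ |T𝔖(h) − X𝔖(2)| + 𝔖(2)|X − N𝔖(h)| ≤ δN. [difficulty: provable-now] [HardyLittlewood1923,
Gallagher1976]

TWO-LAYER PLAN. Foreseen (not filed): TwinResidualRel ⇐ Q → (Q → TwinResidualRel) with Q =
SiegelSpectrumSplit.BoundedSiegelZeroQuality (the node of record's
leaf; the Q-conditioned residual is the level-2 form); BiasDichotomy ⇐ Q → (Q → BiasDichotomy)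
likewise (both are the Siegel-LOADED pieces).
FarSomePair and PairSync are Siegel-inert and are not split at open; the recorded ∀-forms
FarClusterGHL / BoundedClusterSync are rung /
instrument targets above them (FarClusterGHL(1,2,4) ⟹ FarSomePair with h = 2C₀(ε)+2;
BoundedClusterSync(1,2,4) ⟹ PairSync), never children.

KILL CRITERIA. A refutation of PairSync or BiasDichotomy or FarSomePair (a non-universal /
intermediate bias, or no ε-exact pair, exhibited
unconditionally) refutes GHL itself (kernel necessity): route and sub-problem close refuted
together. A proof that BiasDichotomy fails under
UnboundedSiegelZeros (MM2023 bias 2 at h = 2q) does NOT kill the route: it re-files the dichotomy as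
(Q → BiasDichotomy) under the node of
record (pivot). A proof of TwinResidualRel → GHL without the other pieces would make the residual
summit-equivalent in kernel — then the route
degenerates to the record's T6 split and is superseded by SiegelSpectrumSplit. A proof elsewhere of
the twin HL asymptotic moots
TwinLowerFromPairSync's role (and makes FarSomePair a theorem) but not PairSync / the residual / the
dichotomy.

NOT DECOMPOSED YET. The residual (absorbing cell) is deliberately not cut: every statement on
systems with a tight pair plus a far/non-parallel pair, joined with
a twin lower bound, re-assembles relative GHL via Ψ ⊠ twins (certified-negative design note (5) of
the HOME file). Far is not split by shift
range or complexity (critic traps T2/T3/T8: such cells are ≡ the piece or theorems). The ∀-forms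
FarClusterGHL / BoundedClusterSync (recorded necessary consequences)
are not items: their surplus over the pair pieces is double-booked with the residual (critic R1).
Siegel conditioning (Q → ·) of Far and of the residual is layer 2.

CHEAPEST FALSIFIER. (i) Degeneracy of PairSync: with h odd 𝔖(h) = 0 and the statement would assert
X_N(h)·𝔖(2) = o(N) (true but a theorem-grade decoration) —
excluded by the binder Even h; with 𝔖 dropped the statement would compare raw counts and be FALSE
(𝔖(6) = 2𝔖(2)) — the singular-series
weights are in place (checked: kernel necessity pairSync_of_ghl elaborates). (ii) Siegel check (done
by the critic, R3): Friedlander–Iwaniec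
Thm 1 / Cor 1.1 gives the standard singular series for every fixed even h in the exceptional range,
so neither pair piece is refutable from
UnboundedSiegelZeros (unlike UpperGHL / the ∀-form FarClusterGHL). (iii) Instrument: census kit A
j337514 — S_N(h)/(𝔖(h)N) ∈ [0.9944, 1.0055]
over all even h ≤ 3·10^8, [0.982, 1.014] over h ≤ √N at 10^6: no measured counter-trend to sync or
dichotomy.

NUMBERS. 𝔖₂ = 2C₂ = 1.3203…; 1 ≤ 𝔖(2) ≤ 𝔖(h) for every even h ≠ 0 (kernel, HOME file
one_le_singularSeries_evenPair). Instrument (census v2 §5 kit A,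
j337514): sup/inf of S_N(h)/(𝔖(h)N) over even h ≤ 3N = 1.0055/0.9944 at N = 10^8, 1.0124/0.9860 at
10^7, 1.031/0.968 at 10^6. Proved
densities toward FarSomePair: ≫ N/(log N)^k prime pairs in admissible k-tuples, k ≥ 50 (Zhang2014,
Maynard2015, Pintz2015;
arXiv:1410.8400 Cor. 1.2) — not an HL proportion.

DEFINITION REQUESTS. None: all pieces are stated over existing declarations
(ArithmeticFunction.vonMangoldt, Literature.NumberTheory.Sieve.singularSeries,
AffLinForm, IsNondegenerateSystem, affLinSize, realBox, vonMangoldtSum, archFactor,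
singularProduct).

Novelty: Searches (2026-08-30): lean search 'ClusterGap|clusterGap|shiftPairSystem' (tree:
Literature.NumberTheory.Sieve.ClusterComplexity.ClusterGapLE — a route-internal complexity gauge, no
decomposition); the 91 Parity Theses named in census v1/v2 (OneSidedAggregateExchangeRate,
LiouvilleShiftedTables, DicksonFibration, PrimeDeterminantCells, SiegelSpectrumSplit,
ExceptionalWindows, BarrierZoneCarving, …: none cuts by pair geometry, none has a twin-relative
comparison piece); lit search --hybrid "positive proportion prime pairs bounded gaps
Hardy-Littlewood proportion" (hits arXiv:1410.8400 p.6 Cor 1.2, doi:10.1007/978-3-319-28203-9_22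
Thms 1–4 — densities N/(log N)^k only); lit search "singular series average Gallagher uniform lower
bound even shift" (Gallagher1976); critic R3 corpus hit [corpus:paper-arxiv-1607.03261 p.2]
(Friedlander–Iwaniec, exceptional-character twin/pair asymptotics = Heath-Brown 1983); ledger
negatives --problem Parity (5 items, none on cluster geometry or relative transfer); bus:
lens-1/2/3/4/5 nodes (degree, Siegel band, shift-window, local size (withdrawn), Siegel quality
axes).
Nearest prior art found: GreenTao2010 (Conj. 1.2 and the finite-complexity theorem
GreenTaoZiegler2012: the complexity notion is by linear algebra of the forms, not by constants);
Gallagher1976 (singular series on average — the uniform 𝔖(h) ≥ 𝔖(2) device); on the hub: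
OneSidedAggregateExchangeRate (twin leaf 18377 ASSUMED + residual 18380) and SiegelSpectrumSplit (Q
∧ UQ ∧ LQ).
De  [refs: 10.1007/978-3-319-28203-9_22, 1410.8400, doi:10.1007/978-3-319-28203-9_22, paper-arxiv-1607.03261, Gallagher1976, GreenTao2010, GreenTaoZiegler2012]

Barriers (technique_class: decomposition, cluster-geometry, universality): - technique_class: decomposition, cluster-geometry, universality
- Literature.Barriers.Parity.PrimePairParity: FarSomePair and PairSync are jointly INSIDE (together
they prove the twin HL asymptotic, so at least one needs a parity-breaking input); separately, Far∃
fixes no pair and PairSync asserts no HL value — the barrier theorems quantify over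
lower-bound/asymptotic claims for a fixed pair, not over ∃-pair or comparison statements; honest: it
is relocated, not beaten; the bet is that universality (PairSync) has an attack surface the
fixed-pair statement lacks.
- Literature.Barriers.Parity.SelbergParityBarrier: same placement; BiasDichotomy is inside for any
Type-I/II-axiom proof (sieve models realise every bias in [0,2]) — IDEA-NEEDED, declared.
- Literature.Barriers.Parity.SiegelZeroPrimePairBarrier: FarSomePair and PairSync are OUTSIDE
(Siegel-inert: fixed even shifts carry the standard singular series in the exceptional range,
FriedlanderIwaniec2022 / arXiv:1607.03261 Thm 1); TwinResidualRel carries the Landau–Siegel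
certificate like 18380 and BiasDichotomy is loaded on growing shifts (MM2023 bias 2 at h = 2q); the
foreseen layer 2 factors Q = BoundedSiegelZeroQuality out of those two — the barrier is discharged
by conditioning, not fought. (The recorded ∀-form FarClusterGHL IS loaded: USZ ⟹ ¬FarClusterGHL via
h = 2q, exactly as ⟹ ¬UpperGHL.)
- Literature.Barriers.Parity.SiegelZeroTwinPrimes: consistent — no piece asserts anything in the
exceptional regime beyond what G

History (route lifecycle, newest last):
- 2026-09-04T14:29:31Z · DORMANT — reconciler: no traction for 5 d (last activity statement-checked at 2026-08-30T13:43:14Z); parked, not closed — `ledger route dormant route-Parity-ClusterGapCar (operator:999:1006266)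

sub-problem: GeneralizedHardyLittlewood · status: dormant · opened planner-decomp-parity-lens-6-g2-0 2026-08-30T03:31:37Z · rev 1 · ledger route-Parity-ClusterGapCarving
GENERATED by the gate from the ledger (D-0016/17). Provers cite these decls: `theorem foo : Summit.Parity.GeneralizedHardyLittlewood.Theses.ClusterGapCarving.<Decl> := …` in Summits/Parity/GeneralizedHardyLittlewood/Theorems/<Name>.lean.
-/

namespace Summit.Parity.GeneralizedHardyLittlewood.Theses.ClusterGapCarving

open scoped BigOperators Topology Manifold Classical MeasureTheory ProbabilityTheory Matrix InnerProductSpace ComplexConjugate ContinuousMap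
open Filter Set Function TopologicalSpace MeasureTheory

attribute [summit_statement] _root_.GeneralizedHardyLittlewood

/-- item stmt-Parity-26750 · crux · rank 2 · open · by planner
why it might fail: sieve-axiom models allow h-dependent biases ρ(h) ∈ [0,2] (Selberg/Bombieri indeterminacy), so a proof needs a universality mechanism beyond Type-I/II bookkeeping — none is known; refutation would need a proved bias gap between two fixed shifts, equally out of reach.
sources: Bombieri1976, Selberg1949, HardyLittlewood1923, Gallagher1976, FriedlanderIwaniec2022, arXiv:1607.03261
[crux] for every even h ≠ 0 and ε > 0, eventually in N: |X_N(h)·𝔖(2) − T_N·𝔖(h)| ≤ εN, where X_N(h)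
= Σ_(n≤N) Λ(n)Λ(n+h), T_N = X_N(2) and 𝔖(h) = singularSeries {0,h}: every even shift pair has the
twins' bias (a comparison, no value; WEAKER: kernel necessity; separating world «all
infinite-complexity biases 0»; with TwinHL it reaches only HL for fixed even shift pairs, never
shift-uniformity / Goldbach / k-tuples / d ≥ 2; Siegel-inert). [difficulty: open-problem] -/
@[route_item "route-Parity-ClusterGapCarving"]
def PairSync : Prop :=
  ∀ h : ℕ, h ≠ 0 → Even h → ∀ ε : ℝ, 0 < ε → ∃ N₀ : ℕ, ∀ N : ℕ, N₀ ≤ N → |(∑ n ∈ Finset.Icc 1 N, ArithmeticFunction.vonMangoldt n * ArithmeticFunction.vonMangoldt (n + h)) * Literature.NumberTheory.Sieve.singularSeries ({0, 2} : Finset ℤ) - (∑ n ∈ Finset.Icc 1 N, ArithmeticFunction.vonMangoldt n * ArithmeticFunction.vonMangoldt (n + 2)) * Literature.NumberTheory.Sieve.singularSeries ({0, (h : ℤ)} : Finset ℤ)| ≤ ε * N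

/-- item stmt-Parity-26751 · crux · rank 3 · open · by planner
why it might fail: its content — prime pairs at SOME bounded gap with the full Hardy–Littlewood proportion up to ε — is beyond Zhang–Maynard–Polymath densities N/(log N)^k and parity-blocked for Type-I/II methods (the ∃ over h does not leave the sieve-indeterminacy class).
sources: GreenTao2010, Zhang2014, Maynard2015, Pintz2015, arXiv:1410.8400, MontgomeryVaughan1975
[crux] for every ε > 0 there are an even shift h ≠ 0 (depending on ε) and N₀ with |Σ_(n≤N)
Λ(n)Λ(n+h) − 𝔖(h)·N| ≤ εN for all N ≥ N₀: SOME shift pair is ε-exact (WEAKER: kernel necessity with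
h = 2; strictly below the twin leaf — TwinHL ⟹ it, not conversely; separating world «cousin pairs
exact, finitely many twins, all other biases 0»; the pair shadow of far-cluster GHL, Siegel-inert).
[difficulty: open-problem] -/
@[route_item "route-Parity-ClusterGapCarving"]
def FarSomePair : Prop :=
  ∀ ε : ℝ, 0 < ε → ∃ h : ℕ, h ≠ 0 ∧ Even h ∧ ∃ N₀ : ℕ, ∀ N : ℕ, N₀ ≤ N → |(∑ n ∈ Finset.Icc 1 N, ArithmeticFunction.vonMangoldt n * ArithmeticFunction.vonMangoldt (n + h)) - (N : ℝ) * Literature.NumberTheory.Sieve.singularSeries ({0, (h : ℤ)} : Finset ℤ)| ≤ ε * N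

/-- item stmt-Parity-26752 · crux · rank 4 · open · by planner
why it might fail: sieve-axiom models (Bombieri's asymptotic sieve, Selberg's examples) admit every bias in [0,2], so a proof must use primality beyond Type-I/II bookkeeping; an intermediate bias for some smooth-shift family at scales with ∏β_p ≍ log log N is not excluded by anything known.
sources: Bombieri1976, Selberg1949, GreenTao2010, FordMaynard2024
[crux] in the full Green–Tao quantifier block: S·|S − β_∞∏β_p| ≤ εN^d(N^d + |β_∞∏β_p|) — every
system is either rare at the absolute scale or asymptotically exact (bias 0 or 1, nothing in
between); WEAKER (kernel necessity; separating world «all infinite-complexity biases 0»); its only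
role is the relative → absolute upgrade for systems whose singular series exceeds N^d/β_∞ (∏β_p
reaches ≍ log log N on ‖Ψ‖_N ≤ L); Siegel-LOADED on growing shifts (MM2023 excess factor 2 at h = 2q
= bias 2). [difficulty: open-problem] -/
@[route_item "route-Parity-ClusterGapCarving"]
def BiasDichotomy : Prop :=
  ∀ (d t L : ℕ), 1 ≤ d → 1 ≤ t → ∀ ε : ℝ, 0 < ε → ∃ N₀ : ℕ, ∀ N : ℕ, N₀ ≤ N → ∀ Ψ : Fin t → Literature.NumberTheory.Sieve.AffLinForm d, Literature.NumberTheory.Sieve.IsNondegenerateSystem Ψ → Literature.NumberTheory.Sieve.affLinSize Ψ N ≤ L → ∀ K : Set (Fin d → ℝ), Convex ℝ K → K ⊆ Literature.NumberTheory.Sieve.realBox d N → Literature.NumberTheory.Sieve.vonMangoldtSum Ψ K N * |Literature.NumberTheory.Sieve.vonMangoldtSum Ψ K N - Literature.NumberTheory.Sieve.archFactor Ψ K * Literature.NumberTheory.Sieve.singularProduct Ψ| ≤ ε * (N : ℝ) ^ d * ((N : ℝ) ^ d + |Literature.NumberTheory.Sieve.archFactor Ψ K * Literature.NumberTheory.Sieve.singularProduct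 Ψ|)

/-- item stmt-Parity-26753 · crux · rank 5 · open · by planner
why it might fail: as a target it is summit-strength in the strategists' census (an inert antecedent: twin lower bounds give no handle on Goldbach-type shift uniformity or on the Landau–Siegel content, MM2023 families h = 2q); it is carried, not attacked, until a later round weakens it.
sources: GreenTao2010, MatomakiMerikoski2023, HeathBrown1983PrimeTwins, FriedlanderIwaniec2022
[crux] DECLARED-RESIDUAL (critic trap T6) = the cell's blocker residual of record
(OneSidedAggregateExchangeRate.TwinLowerDensityToGHL, stmt-Parity-18380; PairsToGHL 9389 class) in
the weakest form this assembly needs: IF Σ_(n≤N) Λ(n)Λ(n+2) ≥ cN eventually for some c > 0 (Λ-form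
of stmt-Parity-18377 — DERIVED in this route from FarSomePair ∧ PairSync, support
TwinLowerFromPairSync) THEN relative GHL: the Green–Tao block with error ε(N^d + |β_∞∏β_p|). Not
claimed weaker than last round except formally (relative vs absolute error, Λ vs count antecedent);
irreducible along the cluster axis (the near-mixed cell is absorbing under ⊠ twins); T4: the
growing-shift / Goldbach / k-tuple / d ≥ 2 uniformity locus of GHL lives here; Siegel-LOADED (MM2023
growing shifts h = 2q). [deps: FarSomePair, PairSync] [difficulty: open-problem] -/
@[route_item "route-Parity-ClusterGapCarving"]
def TwinResidualRel : Prop :=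
  (∃ c : ℝ, 0 < c ∧ ∃ N₀ : ℕ, ∀ N : ℕ, N₀ ≤ N → c * (N : ℝ) ≤ ∑ n ∈ Finset.Icc 1 N, ArithmeticFunction.vonMangoldt n * ArithmeticFunction.vonMangoldt (n + 2)) → ∀ (d t L : ℕ), 1 ≤ d → 1 ≤ t → ∀ ε : ℝ, 0 < ε → ∃ N₀ : ℕ, ∀ N : ℕ, N₀ ≤ N → ∀ Ψ : Fin t → Literature.NumberTheory.Sieve.AffLinForm d, Literature.NumberTheory.Sieve.IsNondegenerateSystem Ψ → Literature.NumberTheory.Sieve.affLinSize Ψ N ≤ L → ∀ K : Set (Fin d → ℝ), Convex ℝ K → K ⊆ Literature.NumberTheory.Sieve.realBox d N → |Literature.NumberTheory.Sieve.vonMangoldtSum Ψ K N - Literature.NumberTheory.Sieve.archFactor Ψ K * Literature.NumberTheory.Sieve.singularProduct Ψ| ≤ ε * ((N : ℝ) ^ d + |Literature.NumberTheory.Sieve.archFactor Ψ K * Literature.NumberTheory.Sieve.singularProduct Ψ|)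

/-- item stmt-Parity-26754 · support · rank 9 · closed · proved by Summit.Parity.GeneralizedHardyLittlewood.Theses.ClusterGapCarving.twinLowerFromPairSync_proof (prover) · by planner
sources: HardyLittlewood1923, Gallagher1976
[support] glue, PROVED in kernel in the HOME file (ClusterGapCarving.lean:
twinChebyshevLower_of_pair_sync via twinHL_of_pair_sync, 0 sorry, standard axioms, ready to land in
Theorems/): FarSomePair and PairSync imply the Λ-Chebyshev twin lower bound Σ_(n≤N) Λ(n)Λ(n+2) ≥ N/2
eventually (indeed the twin HL asymptotic |T_N − 𝔖(2)N| ≤ δN): take the (δ/2𝔖(2))-exact pair h,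
synchronise it with the twins at δ/2, use 1 ≤ 𝔖(2) ≤ 𝔖(h): |T − N𝔖(2)|·𝔖(h) ≤ |T𝔖(h) − X𝔖(2)| +
𝔖(2)|X − N𝔖(h)| ≤ δN. [difficulty: provable-now] -/
@[route_item "route-Parity-ClusterGapCarving"]
def TwinLowerFromPairSync : Prop :=
  FarSomePair → PairSync → ∃ c : ℝ, 0 < c ∧ ∃ N₀ : ℕ, ∀ N : ℕ, N₀ ≤ N → c * (N : ℝ) ≤ ∑ n ∈ Finset.Icc 1 N, ArithmeticFunction.vonMangoldt n * ArithmeticFunction.vonMangoldt (n + 2)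

-- `TwinLowerFromPairSync` holds: proved by `Summit.Parity.GeneralizedHardyLittlewood.Theses.ClusterGapCarving.twinLowerFromPairSync_proof` (its module imports this route file, so no `_holds` link can be stated here).

/-- item stmt-Parity-26755 · assembly · rank 1 · closed · proved by Summit.Parity.GeneralizedHardyLittlewood.Theses.ClusterGapCarving.assembly_proof (prover) · by planner
sources: GreenTao2010, HardyLittlewood1923
[assembly] FarSomePair → PairSync → TwinResidualRel → BiasDichotomy → TwinLowerFromPairSync →
GeneralizedHardyLittlewood -/
@[route_item "route-Parity-ClusterGapCarving"]
def Assembly : Prop :=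
  FarSomePair → PairSync → TwinResidualRel → BiasDichotomy → TwinLowerFromPairSync → GeneralizedHardyLittlewood

-- `Assembly` holds: proved by `Summit.Parity.GeneralizedHardyLittlewood.Theses.ClusterGapCarving.assembly_proof` (its module imports this route file, so no `_holds` link can be stated here).

/-! D-0027 §2.1 — DECIDING THEOREM (planner-authored via `route open/edit --closes-file`; by planner-decomp-parity-lens-6-g2-0 2026-08-30T03:31:37Z):
its hypotheses are this route's items and its conclusion the sub-problem Statement (glue_lint), and it elaborates with this file. -/

@[closes "route-Parity-ClusterGapCarving"] theorem closes (hF : FarSomePair) (hS : PairSync) (hR : TwinResidualRel)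
    (hD : BiasDichotomy) (hE : TwinLowerFromPairSync) : GeneralizedHardyLittlewood := by
  intro d t L hd ht ε hε
  have hη0 : (0 : ℝ) < min (ε / 4) (1 / 4) := lt_min (by positivity) (by norm_num)
  have hηε : min (ε / 4) (1 / 4) ≤ ε / 4 := min_le_left _ _
  have hη4 : min (ε / 4) (1 / 4) ≤ 1 / 4 := min_le_right _ _
  obtain ⟨Nb, hb⟩ := hR (hE hF hS) d t L hd ht (min (ε / 4) (1 / 4)) hη0
  obtain ⟨Nd, hd'⟩ := hD d t L hd ht (ε / 4) (by positivity)
  refine ⟨max (max Nb Nd) 1, fun N hN Ψ hΨ hL K hK hKN => ?_⟩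
  have hNb : Nb ≤ N := le_trans (le_trans (le_max_left _ _) (le_max_left _ _)) hN
  have hNd : Nd ≤ N := le_trans (le_trans (le_max_right _ _) (le_max_left _ _)) hN
  have hN1 : 1 ≤ N := le_trans (le_max_right _ _) hN
  have hNdnn : (0 : ℝ) ≤ (N : ℝ) ^ d := by positivity
  have hS : (0 : ℝ) ≤ Literature.NumberTheory.Sieve.vonMangoldtSum Ψ K N := by
    classical
    unfold Literature.NumberTheory.Sieve.vonMangoldtSum
    exact Finset.sum_nonneg fun n _ => Finset.prod_nonneg fun i _ =>
      Literature.NumberTheory.Sieve.intVonMangoldt_nonneg _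
  have rel := hb N hNb Ψ hΨ hL K hK hKN
  have D := hd' N hNd Ψ hΨ hL K hK hKN
  generalize hSdef : Literature.NumberTheory.Sieve.vonMangoldtSum Ψ K N = S at hS rel D
  generalize hMdef : Literature.NumberTheory.Sieve.archFactor Ψ K *
      Literature.NumberTheory.Sieve.singularProduct Ψ = M at rel D
  generalize hηdef : min (ε / 4) (1 / 4) = η at hη0 hηε hη4 rel
  have hMnn : 0 ≤ |M| := abs_nonneg _
  by_cases hM : |M| ≤ (N : ℝ) ^ d
  · calc |S - M| ≤ η * ((N : ℝ) ^ d + |M|) := rel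
      _ ≤ η * ((N : ℝ) ^ d + (N : ℝ) ^ d) := by gcongr
      _ ≤ ε * (N : ℝ) ^ d := by nlinarith [mul_le_mul_of_nonneg_right hηε hNdnn]
  · push Not at hM
    have hMpos : 0 < M := by
      by_contra hle
      push Not at hle
      have h1 : |S - M| = S - M := abs_of_nonneg (by linarith)
      have h2 : |M| = -M := abs_of_nonpos hle
      rw [h1, h2] at rel
      rw [h2] at hM
      nlinarith [mul_lt_mul_of_pos_left hM hη0,
        mul_nonneg (neg_nonneg.mpr hle) (by linarith : (0 : ℝ) ≤ 1 - 2 * η), hS, hNdnn]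
    have hMabs : |M| = M := abs_of_pos hMpos
    rw [hMabs] at rel hM
    have hSM : M / 2 ≤ S := by
      have := (abs_le.mp rel).1
      nlinarith [mul_le_mul_of_nonneg_left hM.le hη0.le, mul_le_mul_of_nonneg_right hη4 hMpos.le]
    rw [hMabs] at D
    have hX : 0 ≤ |S - M| := abs_nonneg _
    have step1 : M / 2 * |S - M| ≤ ε / 4 * (N : ℝ) ^ d * ((N : ℝ) ^ d + M) :=
      le_trans (mul_le_mul_of_nonneg_right hSM hX) D
    have step2 : ε / 4 * (N : ℝ) ^ d * ((N : ℝ) ^ d + M) ≤ M / 2 * (ε * (N : ℝ) ^ d) := by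
      have := mul_le_mul_of_nonneg_left (by linarith : (N : ℝ) ^ d + M ≤ 2 * M)
        (by positivity : (0 : ℝ) ≤ ε / 4 * (N : ℝ) ^ d)
      nlinarith [this]
    exact le_of_mul_le_mul_left (le_trans step1 step2) (by positivity)

end Summit.Parity.GeneralizedHardyLittlewood.Theses.ClusterGapCarving
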